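import Summits.ResolutionOfSingularities.ResolutionOfSingularities.Theorems.PurelyInseparableDim4ChartCentreZigzag
import Summits.ResolutionOfSingularities.ResolutionOfSingularities.Theorems.PurelyInseparableDim4ChartChainHistoryEscape
import Summits.ResolutionOfSingularities.ResolutionOfSingularities.Theorems.PurelyInseparableDim4PointZigzagStep
import HarnessLib

/-!
# Purely inseparable four-folds `z^p + F(x₁, …, x₄)`: the CHART OF A CHART through a ZIGZAG chart — after blowing
# up the global centre of a coordinate subspace seen through `Z ← Y → 𝔸⁵`, the next level carries a zigzag chart
# reading the walk's next state (brick (c) 3b of cell `res-dim4-pi`, typ-2 g3 for the joint point∘coordinate chains)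

[OURS · counted 0] (D-0157 DOOR 2; director-resolution DR-157-C; desk WORD #66 (4)(c) / #70 (c); interface asked
for BY SIGNATURE by typ-3 g3, bus 22:03:08Z). Sequel of `PurelyInseparableDim4ChartCentreZigzag.lean` (the global
centre `Zc` of `V(z, x_{S'})` seen through a zigzag chart `Z ←φ— Y —ψ→ 𝔸⁵_K`). PROVED here (no `sorry`, no new
axiom), by typ-3 g2's `IsBlowup.unique` device (`PurelyInseparableDim4PointZigzagStep.lean`) run for a
COORDINATE centre, and — at typ-3 g3's request (bus 22:16:50Z) — for an ARBITRARY centre ideal `Zc` on `Z` with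
`φ^* Zc = ψ^* 𝓘Λ` (`hZφ`), so that both new members (`Zc = 𝓘(closure …)`, `comap_globalCentre_zigzag`) and
survivors (`Zc = (𝓘 c).comap π`) plug in by one rewrite:

* §1 **`exists_iso_restrict_blowup_zigzag`** — for ANY `Zc` with `φ^* Zc = ψ^* 𝓘Λ`, ANY blowing up `π : W → Z`
  of `Zc` and ANY blowing up `B : Bl → 𝔸⁵_K` of `V(x_Λ')` (`𝓘Λ`): both restrict over `Y` to blowings up of `Y`
  along `ψ^* 𝓘Λ`
  (GW Prop. 13.91), hence are ISOMORPHIC over `Y`, `ε : π⁻¹(φ Y) ≅ B⁻¹(ψ Y)` with its square `hsq`, the centre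
  identity `hC'`, and `ε` carries EVERY controlled transform to the corresponding one (BGMW Thm. 8.0.5);
* §2 transport along `ε` for the zigzag chart `W ←φ''— Y'' —ψ''→ 𝔸⁵` built from ANY morphism `φ₀ : 𝔸⁵ ⟶ Bl`
  (`Y'' = φ₀⁻¹ B⁻¹ ψ(Y)`, `φ'' = (φ₀|) ≫ ε⁻¹ ≫ ι`, `ψ''` the inclusion): `zigzag_transport_comap` (ideal sheaves),
  `zigzag_transport_π_apply` (`π(φ'' y) = φ(q)` with `ψ(q) = B(φ₀ y)` — the formula typ-3's cover/hit needs),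
  `zigzag_transport_range`, `zigzag_transport_isClosed`, `zigzag_transport_centre` (the exceptional ideal);
* §3 `chart_apply_mem_CΛ` (the re-centred model chart maps `V(z, x_{S''})`, `S'' ⊇ S'`, over `V(z, x_{S'})`) and
  **`zigzag_chart_of_chart`** (DATA FORM): if `M` of multiplicity `p` reads `φ^* M = ψ^*((z^p + F)·𝒪)`,
  `V(z, x_{S'}) ⊆ ψ(Y)` and `φ(ψ⁻¹ V(z, x_{S'}))` is closed, then for `ε` as in §1 and the re-centred full chart
  `φ₀ = Spec Θ' ≫ chartImm_{j'}` of the MODEL `B` reading `(z^p + G)·𝒪` (typ-2's `controlledTransform_chart_eq_step`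
  gives `Θ'` with `G = (step p S' j' b' s).F`): the zigzag chart of the chart reads `(z^p + G)·𝒪` for
  `M.transform π Zc`, reads `V(x_{j'})` for `π^* Zc`, SEES the whole next centre `V(z, x_{S''})` and has
  `φ''(ψ''⁻¹ V(z, x_{S''}))` CLOSED in `W`, for every `S'' ⊇ S'` — typ-3's zigzag invariant one level deeper.
  Instantiation: `B := blowup.π (𝓘Λ …)` (or any model), `ε, hsq, hC', hKEY` from §1 (`I := M.ideal`,
  `I₀ := hypSheaf p s.F`, `μ := p`), `Θ', h0', hs', hc` from `controlledTransform_chart_eq_step p hj' hbj' s hperm hB`.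

The full-chart ingredients are typ-2's (`controlledTransform_chart_eq_step`, `comap_exceptional_chart`,
`isClosed_image_CΛ_chart`, `chart_comp_eq_specMap`). Nothing here is a statement about resolution of singularities in
dimension ≥ 4 / characteristic `p` (NOT proved anywhere in this programme). bears_on: LADDER-RESOLUTION:D157-DOOR2
(res-dim4-pi). Supports stmt-ResolutionOfSingularities-16155 (helper, (c) 3b).
-/

-- every declaration of this summit lives under `Summit.ResolutionOfSingularities.ResolutionOfSingularities`
-- (summit = problem), which the duplicate-namespace linter flags; house convention (cf. the Target file).
set_option linter.dupNamespace false

noncomputable section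

open MvPolynomial Finset CategoryTheory CategoryTheory.Limits AlgebraicGeometry Opposite TopologicalSpace
open AlgebraicGeometry.Scheme.IdealSheafData (ofIdealTop vanishingIdeal)

namespace Summit.ResolutionOfSingularities.ResolutionOfSingularities.Theorems.PIDim4

open Literature.AlgebraicGeometry.Resolution
open Literature.AlgebraicGeometry.Resolution.AffinePointBlowup (P A γ coord Wtop)

namespace ChartDictionary

/-! ## §1 The two blow-ups are isomorphic over the zigzag piece -/

section IsoDevice

variable {K : Type} [Field K] {Z Y W Bl : Scheme.{0}} (φ : Y ⟶ Z) [IsOpenImmersion φ] (ψ : Y ⟶ P 4 K)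
  [IsOpenImmersion ψ] {π : W ⟶ Z} {B : Bl ⟶ P 4 K}

/-- **The blow-up of the global centre and any blow-up of `𝔸⁵` along `V(x_Λ')` are isomorphic over the zigzag
piece**, compatibly with the projections, the centres, and all controlled transforms (`IsBlowup.unique` over `Y`
after GW Prop. 13.91; BGMW Thm. 8.0.5 for the transforms). -/
theorem exists_iso_restrict_blowup_zigzag [IsLocallyNoetherian Z] (Λ' : Set (Fin (4 + 1)))
    (Zc : Z.IdealSheafData) (hZφ : Zc.comap φ = (AffineCoordBlowup.𝓘Λ 4 K Λ').comap ψ) (hπ : IsBlowup π Zc)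
    (hB : IsBlowup B (AffineCoordBlowup.𝓘Λ 4 K Λ')) :
    ∃ ε : (π ⁻¹ᵁ φ.opensRange : Scheme.{0}) ≅ (B ⁻¹ᵁ ψ.opensRange : Scheme.{0}),
      ε.hom ≫ (B ∣_ ψ.opensRange) = (π ∣_ φ.opensRange) ≫ (φ.isoOpensRange.inv ≫ ψ.isoOpensRange.hom) ∧
      ((AffineCoordBlowup.𝓘Λ 4 K Λ').comap ψ.opensRange.ι).comap (φ.isoOpensRange.inv ≫ ψ.isoOpensRange.hom) =
        Zc.comap φ.opensRange.ι ∧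
      ∀ (I : Z.IdealSheafData) (I₀ : (P 4 K).IdealSheafData) (μ : ℕ), I.comap φ = I₀.comap ψ →
        ((controlledTransform B (AffineCoordBlowup.𝓘Λ 4 K Λ') I₀ μ).comap (B ⁻¹ᵁ ψ.opensRange).ι).comap ε.hom =
          (controlledTransform π Zc I μ).comap (π ⁻¹ᵁ φ.opensRange).ι := by
  haveI : IsProper π := hπ.isProper
  haveI : IsLocallyNoetherian W := LocallyOfFiniteType.isLocallyNoetherian π
  haveI : IsProper B := hB.isProper
  haveI : IsLocallyNoetherian Bl := LocallyOfFiniteType.isLocallyNoetherian B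
  -- notation
  set C := Zc with hC
  set C₀ := AffineCoordBlowup.𝓘Λ 4 K Λ' with hC₀
  set Cy := (AffineCoordBlowup.𝓘Λ 4 K Λ').comap ψ with hCy
  set V : Z.Opens := φ.opensRange with hV
  set U : (P 4 K).Opens := ψ.opensRange with hU
  set e₁ : Y ≅ (V : Scheme.{0}) := φ.isoOpensRange with he₁
  set e₂ : Y ≅ (U : Scheme.{0}) := ψ.isoOpensRange with he₂
  have he₁ι : e₁.hom ≫ V.ι = φ := Scheme.Hom.isoOpensRange_hom_ι φ
  have he₂ι : e₂.hom ≫ U.ι = ψ := Scheme.Hom.isoOpensRange_hom_ι ψ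
  -- the centres, moved to `V` and `U`
  have hCV : (C.comap V.ι).comap e₁.hom = Cy := by
    rw [← Scheme.IdealSheafData.comap_comp, he₁ι]
    exact hZφ
  have hCU : (C₀.comap U.ι).comap e₂.hom = Cy := by
    rw [← Scheme.IdealSheafData.comap_comp, he₂ι]
  -- (A) both restricted blow-ups are blow-ups of `Y` along `Cy`; they are isomorphic over `Y`
  have hcg : C.comap φ = Cy := hZφ
  have hπY : IsBlowup ((π ∣_ V) ≫ e₁.inv) Cy := by
    have h := (hπ.restrict V).comp_iso e₁.symm
    rw [Iso.symm_hom, Iso.symm_inv, ← Scheme.IdealSheafData.comap_comp, he₁ι, hcg] at h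
    exact h
  have hBY : IsBlowup ((B ∣_ U) ≫ e₂.inv) Cy := by
    have h := (hB.restrict U).comp_iso e₂.symm
    rw [Iso.symm_hom, Iso.symm_inv, ← Scheme.IdealSheafData.comap_comp, he₂ι] at h
    exact h
  obtain ⟨ε, hε, -⟩ := hπY.unique hBY
  have hsq : ε.hom ≫ (B ∣_ U) = (π ∣_ V) ≫ (e₁.inv ≫ e₂.hom) := by
    calc ε.hom ≫ (B ∣_ U) = (ε.hom ≫ ((B ∣_ U) ≫ e₂.inv)) ≫ e₂.hom := by
          simp only [Category.assoc, Iso.inv_hom_id, Category.comp_id]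
      _ = ((π ∣_ V) ≫ e₁.inv) ≫ e₂.hom := by rw [hε]
      _ = (π ∣_ V) ≫ (e₁.inv ≫ e₂.hom) := by simp only [Category.assoc]
  have hC' : (C₀.comap U.ι).comap (e₁.inv ≫ e₂.hom) = C.comap V.ι := by
    rw [Scheme.IdealSheafData.comap_comp, hCU, ← hCV, ← Scheme.IdealSheafData.comap_comp, Iso.inv_hom_id,
      Scheme.IdealSheafData.comap_id]
  refine ⟨ε, hsq, hC', fun I I₀ μ hI => ?_⟩
  have hIV : (I.comap V.ι).comap e₁.hom = I₀.comap ψ := by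
    rw [← Scheme.IdealSheafData.comap_comp, he₁ι]
    exact hI
  have hIU : (I₀.comap U.ι).comap e₂.hom = I₀.comap ψ := by
    rw [← Scheme.IdealSheafData.comap_comp, he₂ι]
  have hI' : (I₀.comap U.ι).comap (e₁.inv ≫ e₂.hom) = I.comap V.ι := by
    rw [Scheme.IdealSheafData.comap_comp, hIU, ← hIV, ← Scheme.IdealSheafData.comap_comp, Iso.inv_hom_id,
      Scheme.IdealSheafData.comap_id]
  rw [← controlledTransform_morphismRestrict, ← controlledTransform_morphismRestrict,
    comap_controlledTransform_of_flat (s := ε.hom) (π := B ∣_ U) (π' := π ∣_ V) (e₁.inv ≫ e₂.hom) hsq, hC', hI']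

end IsoDevice

/-! ## §2 Transport along the isomorphism: any full chart of the model gives a zigzag chart of `W` -/

section Transport

variable {K : Type} [Field K] {Z Y W Bl : Scheme.{0}} (φ : Y ⟶ Z) [IsOpenImmersion φ] (ψ : Y ⟶ P 4 K)
  [IsOpenImmersion ψ] {π : W ⟶ Z} {B : Bl ⟶ P 4 K}
  (ε : (π ⁻¹ᵁ φ.opensRange : Scheme.{0}) ≅ (B ⁻¹ᵁ ψ.opensRange : Scheme.{0})) (φ₀ : P 4 K ⟶ Bl)

/-- **Ideal sheaves transport** to the zigzag chart `W ←φ''— Y'' —ψ''→ 𝔸⁵` built from a full chart `φ₀` of the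
model: `Y'' = φ₀⁻¹ B⁻¹ ψ(Y)`, `φ'' = (φ₀| ) ≫ ε⁻¹ ≫ ι`, `ψ''` the inclusion. -/
theorem zigzag_transport_comap (J : Bl.IdealSheafData) (J' : W.IdealSheafData)
    (h : (J.comap (B ⁻¹ᵁ ψ.opensRange).ι).comap ε.hom = J'.comap (π ⁻¹ᵁ φ.opensRange).ι) :
    J'.comap ((φ₀ ∣_ (B ⁻¹ᵁ ψ.opensRange)) ≫ ε.inv ≫ (π ⁻¹ᵁ φ.opensRange).ι) =
      (J.comap φ₀).comap (φ₀ ⁻¹ᵁ (B ⁻¹ᵁ ψ.opensRange)).ι := by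
  rw [Scheme.IdealSheafData.comap_comp, Scheme.IdealSheafData.comap_comp, ← h,
    ← Scheme.IdealSheafData.comap_comp _ ε.inv ε.hom, Iso.inv_hom_id, Scheme.IdealSheafData.comap_id,
    ← Scheme.IdealSheafData.comap_comp, morphismRestrict_ι, Scheme.IdealSheafData.comap_comp]

/-- **Where the zigzag chart of the chart maps to**: `π(φ''(y)) = φ(q)` with `ψ(q) = B(φ₀ y)`. -/
theorem zigzag_transport_π_apply
    (hsq : ε.hom ≫ (B ∣_ ψ.opensRange) = (π ∣_ φ.opensRange) ≫ (φ.isoOpensRange.inv ≫ ψ.isoOpensRange.hom))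
    (y : (φ₀ ⁻¹ᵁ (B ⁻¹ᵁ ψ.opensRange) : Scheme.{0})) :
    π (((φ₀ ∣_ (B ⁻¹ᵁ ψ.opensRange)) ≫ ε.inv ≫ (π ⁻¹ᵁ φ.opensRange).ι) y) =
      φ (ψ.isoOpensRange.inv ((B ∣_ ψ.opensRange) ((φ₀ ∣_ (B ⁻¹ᵁ ψ.opensRange)) y))) ∧
    ψ (ψ.isoOpensRange.inv ((B ∣_ ψ.opensRange) ((φ₀ ∣_ (B ⁻¹ᵁ ψ.opensRange)) y))) = B (φ₀ y.1) := by
  have he₁ι : φ.isoOpensRange.hom ≫ φ.opensRange.ι = φ := Scheme.Hom.isoOpensRange_hom_ι φ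
  have he₂ι : ψ.isoOpensRange.hom ≫ ψ.opensRange.ι = ψ := Scheme.Hom.isoOpensRange_hom_ι ψ
  constructor
  · -- `(π|)(ε⁻¹ z) = e₁ (e₂⁻¹ ((B|) z))`
    have h1 : ((π ∣_ φ.opensRange) ≫ (φ.isoOpensRange.inv ≫ ψ.isoOpensRange.hom))
        (ε.inv ((φ₀ ∣_ (B ⁻¹ᵁ ψ.opensRange)) y)) =
        (B ∣_ ψ.opensRange) ((φ₀ ∣_ (B ⁻¹ᵁ ψ.opensRange)) y) := by
      rw [← hsq, Scheme.Hom.comp_apply, ← Scheme.Hom.comp_apply ε.inv ε.hom, Iso.inv_hom_id]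
      rfl
    have ha : ∀ q : Y, ψ.isoOpensRange.inv (ψ.isoOpensRange.hom q) = q := fun q => by
      rw [← Scheme.Hom.comp_apply, Iso.hom_inv_id]; rfl
    have hb : ∀ r : (φ.opensRange : Scheme.{0}), φ.isoOpensRange.hom (φ.isoOpensRange.inv r) = r := fun r => by
      rw [← Scheme.Hom.comp_apply, Iso.inv_hom_id]; rfl
    have h2 : (π ∣_ φ.opensRange) (ε.inv ((φ₀ ∣_ (B ⁻¹ᵁ ψ.opensRange)) y)) =
        φ.isoOpensRange.hom (ψ.isoOpensRange.inv
          ((B ∣_ ψ.opensRange) ((φ₀ ∣_ (B ⁻¹ᵁ ψ.opensRange)) y))) := by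
      rw [← h1]
      simp only [Scheme.Hom.comp_apply]
      rw [ha, hb]
    rw [Scheme.Hom.comp_apply, Scheme.Hom.comp_apply, ← Scheme.Hom.comp_apply _ π, ← morphismRestrict_ι,
      Scheme.Hom.comp_apply, h2, ← Scheme.Hom.comp_apply _ φ.opensRange.ι, he₁ι]
  · have h3 : ψ.isoOpensRange.inv ≫ ψ = ψ.opensRange.ι := by
      rw [Iso.inv_comp_eq, he₂ι]
    have h4 : ((B ∣_ ψ.opensRange) ≫ ψ.isoOpensRange.inv ≫ ψ) ((φ₀ ∣_ (B ⁻¹ᵁ ψ.opensRange)) y) = B (φ₀ y.1) := by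
      rw [h3, morphismRestrict_ι, Scheme.Hom.comp_apply, Scheme.Opens.ι_apply, morphismRestrict_base_coe]
    simpa only [Scheme.Hom.comp_apply] using h4

/-- **The zigzag chart of the chart sees a set `T`** as soon as the model maps `T` over `ψ(Y)`. -/
theorem zigzag_transport_range (T : Set (P 4 K)) (hT : ∀ y ∈ T, B (φ₀ y) ∈ Set.range ψ) :
    T ⊆ Set.range (φ₀ ⁻¹ᵁ (B ⁻¹ᵁ ψ.opensRange)).ι := by
  intro y hy
  rw [Scheme.Opens.range_ι]
  exact hT y hy

/-- **Closedness transports**: if the model chart image `φ₀(T)` is closed in `Bl` and maps over a set `D ⊆ ψ(Y)`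
with `φ(ψ⁻¹ D)` closed in `Z`, then the zigzag chart image `φ''(ψ''⁻¹ T)` is closed in `W`. -/
theorem zigzag_transport_isClosed
    (hsq : ε.hom ≫ (B ∣_ ψ.opensRange) = (π ∣_ φ.opensRange) ≫ (φ.isoOpensRange.inv ≫ ψ.isoOpensRange.hom))
    (T D : Set (P 4 K)) (hTc : IsClosed (φ₀ '' T)) (hD : IsClosed (φ '' (ψ ⁻¹' D)))
    (hTD : ∀ y ∈ T, B (φ₀ y) ∈ D) :
    IsClosed (((φ₀ ∣_ (B ⁻¹ᵁ ψ.opensRange)) ≫ ε.inv ≫ (π ⁻¹ᵁ φ.opensRange).ι) ''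
      ((φ₀ ⁻¹ᵁ (B ⁻¹ᵁ ψ.opensRange)).ι ⁻¹' T)) := by
  -- (i) the piece inside `B⁻¹ ψ(Y)` is closed there: it is `ι⁻¹ (φ₀ T)`
  have h1 : (φ₀ ∣_ (B ⁻¹ᵁ ψ.opensRange)) '' ((φ₀ ⁻¹ᵁ (B ⁻¹ᵁ ψ.opensRange)).ι ⁻¹' T) =
      ((B ⁻¹ᵁ ψ.opensRange).ι : (B ⁻¹ᵁ ψ.opensRange : Scheme.{0}) → Bl) ⁻¹' (φ₀ '' T) := by
    ext z
    constructor
    · rintro ⟨y, hy, rfl⟩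
      refine ⟨(φ₀ ⁻¹ᵁ (B ⁻¹ᵁ ψ.opensRange)).ι y, hy, ?_⟩
      rw [Scheme.Opens.ι_apply]
      change φ₀ y.1 = ((φ₀ ∣_ (B ⁻¹ᵁ ψ.opensRange)) y).1
      rw [morphismRestrict_base_coe]
    · rintro ⟨y, hyT, hyz⟩
      have hyO : y ∈ φ₀ ⁻¹ᵁ (B ⁻¹ᵁ ψ.opensRange) := by
        change φ₀ y ∈ B ⁻¹ᵁ ψ.opensRange
        rw [hyz]
        exact z.2
      refine ⟨⟨y, hyO⟩, hyT, ?_⟩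
      apply Subtype.ext
      rw [morphismRestrict_base_coe]
      exact hyz
  have h2 : IsClosed ((φ₀ ∣_ (B ⁻¹ᵁ ψ.opensRange)) '' ((φ₀ ⁻¹ᵁ (B ⁻¹ᵁ ψ.opensRange)).ι ⁻¹' T)) := by
    rw [h1]
    exact hTc.preimage (B ⁻¹ᵁ ψ.opensRange).ι.continuous
  -- (ii) transported along `ε⁻¹` it is closed in `π⁻¹ φ(Y)`
  have h3 : ε.inv '' ((φ₀ ∣_ (B ⁻¹ᵁ ψ.opensRange)) '' ((φ₀ ⁻¹ᵁ (B ⁻¹ᵁ ψ.opensRange)).ι ⁻¹' T)) =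
      (ε.hom : (π ⁻¹ᵁ φ.opensRange : Scheme.{0}) → (B ⁻¹ᵁ ψ.opensRange : Scheme.{0})) ⁻¹'
        ((φ₀ ∣_ (B ⁻¹ᵁ ψ.opensRange)) '' ((φ₀ ⁻¹ᵁ (B ⁻¹ᵁ ψ.opensRange)).ι ⁻¹' T)) := by
    ext q
    constructor
    · rintro ⟨z, hz, rfl⟩
      show ε.hom (ε.inv z) ∈ (φ₀ ∣_ (B ⁻¹ᵁ ψ.opensRange)) '' ((φ₀ ⁻¹ᵁ (B ⁻¹ᵁ ψ.opensRange)).ι ⁻¹' T)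
      rw [← Scheme.Hom.comp_apply, Iso.inv_hom_id]
      exact hz
    · intro hq
      refine ⟨ε.hom q, hq, ?_⟩
      rw [← Scheme.Hom.comp_apply, Iso.hom_inv_id]
      rfl
  have h4 : IsClosed (ε.inv '' ((φ₀ ∣_ (B ⁻¹ᵁ ψ.opensRange)) ''
      ((φ₀ ⁻¹ᵁ (B ⁻¹ᵁ ψ.opensRange)).ι ⁻¹' T))) := by
    rw [h3]
    exact h2.preimage ε.hom.continuous
  -- (iii) its image in `W` lies over the closed `φ(ψ⁻¹ D)`, which lies in `φ(Y)`; hence it is closed in `W`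
  have himage : ((φ₀ ∣_ (B ⁻¹ᵁ ψ.opensRange)) ≫ ε.inv ≫ (π ⁻¹ᵁ φ.opensRange).ι) ''
      ((φ₀ ⁻¹ᵁ (B ⁻¹ᵁ ψ.opensRange)).ι ⁻¹' T) =
      (π ⁻¹ᵁ φ.opensRange).ι '' (ε.inv '' ((φ₀ ∣_ (B ⁻¹ᵁ ψ.opensRange)) ''
        ((φ₀ ⁻¹ᵁ (B ⁻¹ᵁ ψ.opensRange)).ι ⁻¹' T))) := by
    rw [Set.image_image, Set.image_image]
    refine Set.image_congr' fun y => ?_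
    simp only [Scheme.Hom.comp_apply]
  have hover : ((φ₀ ∣_ (B ⁻¹ᵁ ψ.opensRange)) ≫ ε.inv ≫ (π ⁻¹ᵁ φ.opensRange).ι) ''
      ((φ₀ ⁻¹ᵁ (B ⁻¹ᵁ ψ.opensRange)).ι ⁻¹' T) ⊆ π ⁻¹' (φ '' (ψ ⁻¹' D)) := by
    rintro _ ⟨y, hy, rfl⟩
    obtain ⟨hπy, hψy⟩ := zigzag_transport_π_apply φ ψ ε φ₀ hsq y
    rw [Set.mem_preimage, hπy]
    refine ⟨_, ?_, rfl⟩
    rw [Set.mem_preimage, hψy]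
    exact hTD y.1 hy
  rw [himage]
  refine isClosed_image_of_isInducing (π ⁻¹ᵁ φ.opensRange).ι.isOpenEmbedding.isInducing h4 ?_
  rw [← himage]
  refine ((hD.preimage π.continuous).closure_subset_iff.mpr hover).trans ?_
  rintro w ⟨y, -, hyw⟩
  rw [Scheme.Opens.range_ι]
  change π w ∈ φ.opensRange
  rw [← hyw]
  exact ⟨y, rfl⟩

/-- **The centre transports**: from the square `ε ≫ (B|) = (π|) ≫ e₁⁻¹ ≫ e₂` and the identification of the centres
over `Y`, the exceptional ideal `π^* C` on `π⁻¹ φ(Y)` is `ε^*` of the exceptional ideal `B^* C₀` on `B⁻¹ ψ(Y)`. -/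
theorem zigzag_transport_centre (C₀ : (P 4 K).IdealSheafData) (C : Z.IdealSheafData)
    (hsq : ε.hom ≫ (B ∣_ ψ.opensRange) = (π ∣_ φ.opensRange) ≫ (φ.isoOpensRange.inv ≫ ψ.isoOpensRange.hom))
    (hC' : (C₀.comap ψ.opensRange.ι).comap (φ.isoOpensRange.inv ≫ ψ.isoOpensRange.hom) =
      C.comap φ.opensRange.ι) :
    ((C₀.comap B).comap (B ⁻¹ᵁ ψ.opensRange).ι).comap ε.hom = (C.comap π).comap (π ⁻¹ᵁ φ.opensRange).ι := by
  calc ((C₀.comap B).comap (B ⁻¹ᵁ ψ.opensRange).ι).comap ε.hom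
        = C₀.comap ((ε.hom ≫ (B ∣_ ψ.opensRange)) ≫ ψ.opensRange.ι) := by
          rw [Category.assoc, morphismRestrict_ι, Scheme.IdealSheafData.comap_comp,
            Scheme.IdealSheafData.comap_comp]
    _ = ((C₀.comap ψ.opensRange.ι).comap (φ.isoOpensRange.inv ≫ ψ.isoOpensRange.hom)).comap
          (π ∣_ φ.opensRange) := by
          rw [hsq, Category.assoc, Scheme.IdealSheafData.comap_comp, Scheme.IdealSheafData.comap_comp]
    _ = (C.comap π).comap (π ⁻¹ᵁ φ.opensRange).ι := by
          rw [hC', ← Scheme.IdealSheafData.comap_comp, morphismRestrict_ι, Scheme.IdealSheafData.comap_comp]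

end Transport

/-! ## §3 The zigzag chart of the chart -/

section ChartOfChart

variable {K : Type} [Field K] {Z Y W Bl : Scheme.{0}} (φ : Y ⟶ Z) [IsOpenImmersion φ] (ψ : Y ⟶ P 4 K)
  [IsOpenImmersion ψ] {π : W ⟶ Z} {B : Bl ⟶ P 4 K} {S' S'' : Finset (Fin 4)} {j' : Fin 4}

omit [IsOpenImmersion φ] [IsOpenImmersion ψ] in
/-- **The re-centred model chart maps the next centre over the old one**: for `S' ⊆ S''` and any re-centring
`Θ'` fixing `x_{j'}` up to the translation `b'` (`b'_{j'} = 0`), `B(φ₀(V(z, x_{S''}))) ⊆ V(z, x_{S'})`,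
`φ₀ = Spec Θ' ≫ chartImm_{j'}`. -/
theorem chart_apply_mem_CΛ (hB : IsBlowup B (AffineCoordBlowup.𝓘Λ 4 K (insert 0 (Fin.succ '' (S' : Set (Fin 4))))))
    (hj' : j' ∈ S') {Θ' : A 4 K →+* A 4 K} {b' : Fin 4 → K} (hbj' : b' j' = 0)
    (hs' : ∀ k : Fin 4, Θ' (X k.succ) = X k.succ + C (b' k)) (hsub : S' ⊆ S'') {y : P 4 K}
    (hy : y ∈ AffineCoordBlowup.CΛ 4 K (insert 0 (Fin.succ '' (S'' : Set (Fin 4))))) :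
    B ((Spec.map (CommRingCat.ofHom Θ') ≫ AffineCoordBlowup.chartImm hB (succ_mem_centreVars hj')) y) ∈
      AffineCoordBlowup.CΛ 4 K (insert 0 (Fin.succ '' (S' : Set (Fin 4)))) := by
  rw [← Scheme.Hom.comp_apply, chart_comp_eq_specMap hB (succ_mem_centreVars hj') Θ',
    AffineCoordBlowup.mem_CΛ_iff']
  have hy' := (AffineCoordBlowup.mem_CΛ_iff' 4 K _ y).mp hy
  have hXj' : (X j'.succ : A 4 K) ∈ y.asIdeal := hy' j'.succ (succ_mem_centreVars (hsub hj'))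
  intro m hm
  rw [Spec.map_apply, PrimeSpectrum.comap_asIdeal, Ideal.mem_comap, CommRingCat.hom_ofHom, RingHom.comp_apply,
    AlgHom.toRingHom_eq_coe, AlgHom.coe_toRingHom]
  rcases hm with hm | ⟨k, hk, rfl⟩
  · rw [hm, clean_subst_X_zero hbj' hs']
    exact Ideal.mul_mem_right _ _ hXj'
  · by_cases hkj : k = j'
    · subst hkj
      rw [clean_subst_X_chart hbj' hs']
      exact hXj'
    · rw [clean_subst_X_fibre hbj' hs' hk hkj]
      exact Ideal.mul_mem_right _ _ hXj'

/-- **THE ZIGZAG CHART OF THE CHART (data form).** Let `Z ←φ— Y —ψ→ 𝔸⁵_K` be a zigzag chart seeing the whole centre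
`V(z, x_{S'}) ⊆ ψ(Y)` with `φ(ψ⁻¹ V(z, x_{S'}))` closed, `π : W → Z` any blowing up of the global centre `Zc`,
`B : Bl → 𝔸⁵_K` any blowing up of `V(z, x_{S'})`, `ε : π⁻¹ φ(Y) ≅ B⁻¹ ψ(Y)` the comparison of
`exists_iso_restrict_blowup_zigzag` (its square `hsq`, centre identity `hC'` and transform transport `hKEY` for the
marked ideal `M` of multiplicity `p` reading `φ^*M = ψ^*((z^p + s.F)·𝒪)`), and `φ₀ = Spec Θ' ≫ chartImm_{j'}` a
re-centred full chart of the MODEL reading `(z^p + G)·𝒪` (`Θ' z = z + h'(x)`, `Θ' xᵢ = xᵢ + b'ᵢ`, `b'_{j'} = 0`). Then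
the zigzag chart `W ←φ''— Y'' —ψ''→ 𝔸⁵` (`Y'' = φ₀⁻¹ B⁻¹ ψ(Y)`, `φ'' = (φ₀|) ≫ ε⁻¹ ≫ ι`, `ψ''` the inclusion) reads
`(z^p + G)·𝒪` for `M.transform π Zc`, reads `V(x_{j'})` for the exceptional ideal `π^* Zc`, SEES the whole next centre
`V(z, x_{S''})` and has `φ''(ψ''⁻¹ V(z, x_{S''}))` CLOSED in `W`, for every `S'' ⊇ S'`. -/
theorem zigzag_chart_of_chart {p : ℕ} (M : MarkedIdeal Z) (hmult : M.mult = p) (F G : MvPolynomial (Fin 4) K)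
    (Zc : Z.IdealSheafData)
    (hsee : (AffineCoordBlowup.CΛ 4 K (insert 0 (Fin.succ '' (S' : Set (Fin 4)))) : Set (P 4 K)) ⊆ Set.range ψ)
    (hT : IsClosed (φ '' (ψ ⁻¹'
      (AffineCoordBlowup.CΛ 4 K (insert 0 (Fin.succ '' (S' : Set (Fin 4)))) : Set (P 4 K)))))
    (hB : IsBlowup B (AffineCoordBlowup.𝓘Λ 4 K (insert 0 (Fin.succ '' (S' : Set (Fin 4))))))
    (ε : (π ⁻¹ᵁ φ.opensRange : Scheme.{0}) ≅ (B ⁻¹ᵁ ψ.opensRange : Scheme.{0}))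
    (hsq : ε.hom ≫ (B ∣_ ψ.opensRange) = (π ∣_ φ.opensRange) ≫ (φ.isoOpensRange.inv ≫ ψ.isoOpensRange.hom))
    (hC' : ((AffineCoordBlowup.𝓘Λ 4 K (insert 0 (Fin.succ '' (S' : Set (Fin 4))))).comap ψ.opensRange.ι).comap
        (φ.isoOpensRange.inv ≫ ψ.isoOpensRange.hom) = Zc.comap φ.opensRange.ι)
    (hKEY : ((controlledTransform B (AffineCoordBlowup.𝓘Λ 4 K (insert 0 (Fin.succ '' (S' : Set (Fin 4)))))
        (hypSheaf p F) p).comap (B ⁻¹ᵁ ψ.opensRange).ι).comap ε.hom =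
      (controlledTransform π Zc M.ideal p).comap (π ⁻¹ᵁ φ.opensRange).ι)
    (hj' : j' ∈ S') {b' : Fin 4 → K} (hbj' : b' j' = 0) {Θ' : A 4 K ≃ₐ[K] A 4 K} {h' : MvPolynomial (Fin 4) K}
    (h0' : Θ' (X 0) = X 0 + rename Fin.succ h') (hs' : ∀ i : Fin 4, Θ' (X i.succ) = X i.succ + C (b' i))
    (hc : (controlledTransform B (AffineCoordBlowup.𝓘Λ 4 K (insert 0 (Fin.succ '' (S' : Set (Fin 4)))))
        (hypSheaf p F) p).comap
        (Spec.map (CommRingCat.ofHom (Θ' : A 4 K →+* A 4 K)) ≫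
          AffineCoordBlowup.chartImm hB (succ_mem_centreVars hj')) = hypSheaf p G) :
    (M.transform π Zc).ideal.comap
        (((Spec.map (CommRingCat.ofHom (Θ' : A 4 K →+* A 4 K)) ≫
            AffineCoordBlowup.chartImm hB (succ_mem_centreVars hj')) ∣_ (B ⁻¹ᵁ ψ.opensRange)) ≫
          ε.inv ≫ (π ⁻¹ᵁ φ.opensRange).ι) =
      (hypSheaf p G).comap ((Spec.map (CommRingCat.ofHom (Θ' : A 4 K →+* A 4 K)) ≫
        AffineCoordBlowup.chartImm hB (succ_mem_centreVars hj')) ⁻¹ᵁ (B ⁻¹ᵁ ψ.opensRange)).ι ∧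
    (Zc.comap π).comap
        (((Spec.map (CommRingCat.ofHom (Θ' : A 4 K →+* A 4 K)) ≫
            AffineCoordBlowup.chartImm hB (succ_mem_centreVars hj')) ∣_ (B ⁻¹ᵁ ψ.opensRange)) ≫
          ε.inv ≫ (π ⁻¹ᵁ φ.opensRange).ι) =
      (ofIdealTop (Ideal.span {coord 4 K j'.succ})).comap
        ((Spec.map (CommRingCat.ofHom (Θ' : A 4 K →+* A 4 K)) ≫
          AffineCoordBlowup.chartImm hB (succ_mem_centreVars hj')) ⁻¹ᵁ (B ⁻¹ᵁ ψ.opensRange)).ι ∧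
    ∀ S'' : Finset (Fin 4), S' ⊆ S'' →
      (AffineCoordBlowup.CΛ 4 K (insert 0 (Fin.succ '' (S'' : Set (Fin 4)))) : Set (P 4 K)) ⊆
        Set.range ((Spec.map (CommRingCat.ofHom (Θ' : A 4 K →+* A 4 K)) ≫
          AffineCoordBlowup.chartImm hB (succ_mem_centreVars hj')) ⁻¹ᵁ (B ⁻¹ᵁ ψ.opensRange)).ι ∧
      IsClosed ((((Spec.map (CommRingCat.ofHom (Θ' : A 4 K →+* A 4 K)) ≫
            AffineCoordBlowup.chartImm hB (succ_mem_centreVars hj')) ∣_ (B ⁻¹ᵁ ψ.opensRange)) ≫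
          ε.inv ≫ (π ⁻¹ᵁ φ.opensRange).ι) ''
        (((Spec.map (CommRingCat.ofHom (Θ' : A 4 K →+* A 4 K)) ≫
            AffineCoordBlowup.chartImm hB (succ_mem_centreVars hj')) ⁻¹ᵁ (B ⁻¹ᵁ ψ.opensRange)).ι ⁻¹'
          (AffineCoordBlowup.CΛ 4 K (insert 0 (Fin.succ '' (S'' : Set (Fin 4)))) : Set (P 4 K)))) := by
  have hs'' : ∀ i : Fin 4, (Θ' : A 4 K →+* A 4 K) (X i.succ) = X i.succ + C (b' i) := fun i => hs' i
  have hΘ'j : (Θ' : A 4 K →+* A 4 K) (X j'.succ) = X j'.succ := by rw [hs'' j', hbj', C_0, add_zero]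
  refine ⟨?_, ?_, fun S'' hsub => ⟨?_, ?_⟩⟩
  · -- the reading of the transformed marked ideal
    rw [MarkedIdeal.transform_ideal, hmult,
      zigzag_transport_comap φ ψ ε _ _ _ hKEY, hc]
  · -- the exceptional ideal
    rw [zigzag_transport_comap φ ψ ε _ _ _ (zigzag_transport_centre φ ψ ε _ _ hsq hC'),
      comap_exceptional_chart hj' hΘ'j hB]
  · -- the new chart sees the whole next centre
    exact zigzag_transport_range ψ _ _ fun y hy => hsee (chart_apply_mem_CΛ hB hj' hbj' hs'' hsub hy)
  · -- closedness of the next centre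
    exact zigzag_transport_isClosed φ ψ ε _ hsq _ _ (isClosed_image_CΛ_chart hj' hbj' h0' hs' hB
      ((Finset.erase_subset j' S').trans hsub)) hT (fun y hy => chart_apply_mem_CΛ hB hj' hbj' hs'' hsub hy)

end ChartOfChart

end ChartDictionary

end Summit.ResolutionOfSingularities.ResolutionOfSingularities.Theorems.PIDim4

end
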